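import Summits.BirchSwinnertonDyer.BirchSwinnertonDyer.Theorems.ClassRecordThreeCartanSupplyOneSidedTypeCut
import Summits.BirchSwinnertonDyer.BirchSwinnertonDyer.Theorems.ClassRecordThreeCartanSupplyCubicCharacterTables
import Summits.BirchSwinnertonDyer.BirchSwinnertonDyer.Theorems.ClassRecordThreeCartanSupplyHeckeFamily
import Summits.BirchSwinnertonDyer.BirchSwinnertonDyer.Theorems.ClassRecordThreeCartanNaturalAssembly
import Summits.BirchSwinnertonDyer.BirchSwinnertonDyer.Theses.ClassRecordThree
import Summits.BirchSwinnertonDyer.BirchSwinnertonDyer.Theses.KolyvaginRoadThree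
import HarnessLib

/-!
# The crux decls BY NAME from the leaves — §5 of the `doublecoset` certificate for crux 24801 `CartanOnePlaceDegreeLawAtThree` (leaf module: nothing should import it)

Lift-only port (cell bsd-stepL, SUMMON key `k5-lift1`, director-bsd (734)(1) CONCUR 2026-08-31) of §5 minus `CartanOnePlaceDegreeLawAtThree_of_stubs` and minus `CartanOnePlaceDegreeLawAtThree_of_printInputsThree` (source lines 2766–2852, 2859–2865) of the crux-ideate workfile
`Summits/BirchSwinnertonDyer/BirchSwinnertonDyer/Cruxes/CartanOnePlaceDegreeLawAtThree/Lines/doublecoset.lean` (lineage `cruxidea-stmt-BirchSwinnertonDyer-24801-1`, generation 22,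
commit 721e9ccbdf4b, sha256-16 d3adee7328f6a76c, 2876 l.; farm rc 0, sorries 4 = its §4 stubs, none of which is lifted; referee landing record `VERDICT-DOUBLECOSET-G22-g88.md`).
Declarations, statements and proofs below are BYTE-IDENTICAL to the source; the only edits are the namespace (`…Cruxes.CartanOnePlaceDegreeLawAtThree.Doublecoset` ↦
`…Theorems.CartanDoubleCoset`, shared by the nine `ClassRecordThreeCartanSupply*` modules), the imports ∕ `open`s each module needs, and one-line docstrings added where the source
had none. Nothing is re-stated, weakened or re-proved.

CONTENT (hypothesis-taking compositions, real proofs, NO stub consumed; all CONDITIONAL on their hypotheses — they close nothing): `cartanOnePlaceDegreeLawAtThreeNatural_of`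
(NUM♮ = `CartanCorrespondence.CartanOnePlaceDegreeLawAtThreeNatural`, the item-32276 signature, from (L1S), (BCV), (VAN), (FGT), (DS) ∧ (JLᶜ)), `CartanOnePlaceDegreeLawAtThree_of`,
`…_of₄`, `…_of₄'` (the `KolyvaginRoadThree` twin), `CartanOnePlaceDegreeLawAtThreeNatural_of₄` (item 32276 decl on `ClassRecordThree`), `…_of_heckecut`, `…_of_heckecut'`,
`CartanOnePlaceDegreeLawAtThreeNatural_of_heckecut`, **`CartanOnePlaceDegreeLawAtThree_of_doublecoset : (MO1) → (BCV) → (VAN) → ((DS) ∧ (JLᶜ)) → Theses.ClassRecordThree.CartanOnePlaceDegreeLawAtThree`**,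
`…_of_doublecoset'` (KR3 twin), `CartanOnePlaceDegreeLawAtThreeNatural_of_doublecoset`, `…_of₆`. TWO deliberate deviations from the source, both forced by gate lints and both
statement-neutral: (i) `CartanOnePlaceDegreeLawAtThree_of_printInputsThree` (source l.2867–2872) is NOT lifted — it restates the landed
`CartanNaturalChain.classRecordThree_cartanOnePlaceDegreeLawAtThree_of_printInputsThreeNatural` (`dedup.landed`; cite that one); (ii) the two proof terms that went through
`ClassRecordThreeCartanNaturalRouteClosers` (`classRecordThree_…` ∕ `kolyvaginRoadThree_cartanOnePlaceDegreeLawAtThree_of_printInputsThreeNatural`) are unfolded to their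
route-independent definiens `CartanCorrespondence.cartanOnePlaceDegreeLawAtThree_of_natural (CartanNaturalChain.cartanOnePlaceDegreeLawAtThreeNatural_of_printInputsThree _)`, so that
this module imports the two route files directly and no Theorems module that imports one (`lint.theses-cone`); statements byte-identical. NB the port is TEN modules, not nine as the shared custody paragraph says: the §5 compositions were split off `…HeckeFamily` into the leaf module `ClassRecordThreeCartanSupplyCompositions` at landing time (gate `lint.theses-cone`).

HONEST: a `--supports stmt-BirchSwinnertonDyer-24801` helper module; it proves NOTHING about NUM ∕ NUM♮ (items 24801 ∕ 32276) or crux 19109 for any curve — the leaves (MO1)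
`SplitLevelMultiplicityOne`, (BCV) `BorelCubicEigenDocking`, (VAN) `NonsplitTorusCubicVanishing`, (DS) ∧ (JLᶜ) stay OPEN; registry `Lines/petarea.lean` rev 8 untouched; BSD is proved for no curve.
-/

set_option linter.dupNamespace false  -- `Summit.BirchSwinnertonDyer.BirchSwinnertonDyer.…` (summit = problem), as every file of this directory
set_option autoImplicit false

noncomputable section

open scoped Classical MatrixGroups
open Matrix

namespace Summit.BirchSwinnertonDyer.BirchSwinnertonDyer.Theorems.CartanDoubleCoset

open Summit.BirchSwinnertonDyer.BirchSwinnertonDyer.Theorems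
open Summit.BirchSwinnertonDyer.BirchSwinnertonDyer.Theorems.CartanDegree (HasRatEigenvalue)
open Summit.BirchSwinnertonDyer.BirchSwinnertonDyer.Theorems.CartanTorusCubeCut (torusSubgroup mem_torusSubgroup lin linGL linGL_coe lin_comm torusSubgroup_isCyclic card_torusSubgroup)
open Summit.BirchSwinnertonDyer.BirchSwinnertonDyer.Theorems.CartanCover (splitGen mem_splitTorus_iff)
open Summit.BirchSwinnertonDyer.BirchSwinnertonDyer.Theorems.CartanCover.Charext.InertHecke (upperUnip lowerUnip coe_upperUnip coe_lowerUnip upperUnip_mul upperUnip_zero exists_unip_factorization)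
open scoped Pointwise ModularForm NumberField
open Module UpperHalfPlane
open Literature.NumberTheory.Automorphic WeierstrassCurve Literature.NumberTheory.EllipticCurves Literature.NumberTheory.EllipticCurves.ModularForms
open Literature.NumberTheory.EllipticCurves.Rank1Residual Summit.BirchSwinnertonDyer.Rank1Residual Literature.NumberTheory.GaloisRepresentations NumberField IsDedekindDomain
open Summit.BirchSwinnertonDyer.BirchSwinnertonDyer.Theorems.CartanCover
open Summit.BirchSwinnertonDyer.BirchSwinnertonDyer.Theorems.CartanCover.CMRank
open Summit.BirchSwinnertonDyer.BirchSwinnertonDyer.Theorems.CartanTorusCubeCut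
open Summit.BirchSwinnertonDyer.BirchSwinnertonDyer.Theorems.CartanNaturalChain
open Summit.BirchSwinnertonDyer.BirchSwinnertonDyer.Theorems.CartanDegree (cubicNewvectorChar HasRatEigenvalue)

/-! ## §5 Composition — NUM♮ and the crux decls BY NAME (real proofs, no sorry; (L1S) is supplied by the THEOREM `splitFixedRankOne_of_multiplicityOne` ((HF♭) PROVED, §I), (SPH) and
(FGT-PS) ∧ (FGT-C) by the THEOREMS `sphericalTransfer`, `cubicCharacterTables`) -/

/-- **NUM♮ (`CartanCorrespondence.CartanOnePlaceDegreeLawAtThreeNatural`, the 32276 signature) from the four leaves and the inputs of record** (generation 19, verbatim). -/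
theorem cartanOnePlaceDegreeLawAtThreeNatural_of (hL1S : SplitFixedRankOne)
    (hBCV : BorelCubicEigenDocking) (hVAN : NonsplitTorusCubicVanishing) (hFGT : CubicPrincipalSeriesCharacter ∧ CubicCuspidalCharacter)
    (hGT : DeligneSerre1974.thm61_exists_adicGaloisRep ∧ Literature.NumberTheory.Automorphic.jacquetLanglands_cartanCover_newform) :
    CartanCorrespondence.CartanOnePlaceDegreeLawAtThreeNatural :=
  cartanOnePlaceDegreeLawAtThreeNatural_of_printInputsThree ⟨coverIsotypicComponent_of_lines' hL1S hBCV hVAN hFGT, hGT⟩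

/-- **THE CRUX DECL BY NAME on `ClassRecordThree`** from the five statements of generation 19 (verbatim; (FGT) still a hypothesis here). -/
theorem CartanOnePlaceDegreeLawAtThree_of :
    SplitFixedRankOne → BorelCubicEigenDocking → NonsplitTorusCubicVanishing →
      (CubicPrincipalSeriesCharacter ∧ CubicCuspidalCharacter) →
      (DeligneSerre1974.thm61_exists_adicGaloisRep ∧ Literature.NumberTheory.Automorphic.jacquetLanglands_cartanCover_newform) →
      Summit.BirchSwinnertonDyer.BirchSwinnertonDyer.Theses.ClassRecordThree.CartanOnePlaceDegreeLawAtThree :=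
  fun hL1S hBCV hVAN hFGT hGT ↦
    CartanCorrespondence.cartanOnePlaceDegreeLawAtThree_of_natural (cartanOnePlaceDegreeLawAtThreeNatural_of_printInputsThree ⟨coverIsotypicComponent_of_lines' hL1S hBCV hVAN hFGT, hGT⟩)

/-- Generation 20's composition (verbatim): the crux decl BY NAME on `ClassRecordThree` from (L1S), (BCV), (VAN), ((DS) ∧ (JLᶜ)); the character tables are the
THEOREM `cubicCharacterTables`. -/
theorem CartanOnePlaceDegreeLawAtThree_of₄ :
    SplitFixedRankOne → BorelCubicEigenDocking → NonsplitTorusCubicVanishing →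
      (DeligneSerre1974.thm61_exists_adicGaloisRep ∧ Literature.NumberTheory.Automorphic.jacquetLanglands_cartanCover_newform) →
      Summit.BirchSwinnertonDyer.BirchSwinnertonDyer.Theses.ClassRecordThree.CartanOnePlaceDegreeLawAtThree :=
  fun hL1S hBCV hVAN hGT ↦ CartanOnePlaceDegreeLawAtThree_of hL1S hBCV hVAN cubicCharacterTables hGT

/-- Generation 20's `KolyvaginRoadThree` twin (verbatim). -/
theorem CartanOnePlaceDegreeLawAtThree_of₄' :
    SplitFixedRankOne → BorelCubicEigenDocking → NonsplitTorusCubicVanishing →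
      (DeligneSerre1974.thm61_exists_adicGaloisRep ∧ Literature.NumberTheory.Automorphic.jacquetLanglands_cartanCover_newform) →
      Summit.BirchSwinnertonDyer.BirchSwinnertonDyer.Theses.KolyvaginRoadThree.CartanOnePlaceDegreeLawAtThree :=
  fun hL1S hBCV hVAN hGT ↦
    CartanCorrespondence.cartanOnePlaceDegreeLawAtThree_of_natural (cartanOnePlaceDegreeLawAtThreeNatural_of_printInputsThree
      ⟨coverIsotypicComponent_of_lines' hL1S hBCV hVAN cubicCharacterTables, hGT⟩)

/-- Generation 20's NUM♮ ITEM decl (32276) on `ClassRecordThree` from the four statements (verbatim). -/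
theorem CartanOnePlaceDegreeLawAtThreeNatural_of₄ :
    SplitFixedRankOne → BorelCubicEigenDocking → NonsplitTorusCubicVanishing →
      (DeligneSerre1974.thm61_exists_adicGaloisRep ∧ Literature.NumberTheory.Automorphic.jacquetLanglands_cartanCover_newform) →
      Summit.BirchSwinnertonDyer.BirchSwinnertonDyer.Theses.ClassRecordThree.CartanOnePlaceDegreeLawAtThreeNatural :=
  fun hL1S hBCV hVAN hGT ↦ cartanOnePlaceDegreeLawAtThreeNatural_of hL1S hBCV hVAN cubicCharacterTables hGT

/-- **THIS NODE'S COMPOSITION — THE CRUX DECL BY NAME on `ClassRecordThree` from FIVE statements**: (HF), (MO1), (BCV), (VAN), ((DS) ∧ (JLᶜ)); (L1S) is the THEOREM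
`splitFixedRankOne_of_heckeFamily`, the character tables the THEOREM `cubicCharacterTables`, (SPH) the THEOREM `sphericalTransfer`. -/
theorem CartanOnePlaceDegreeLawAtThree_of_heckecut :
    CoverHeckeFamily → SplitLevelMultiplicityOne → BorelCubicEigenDocking → NonsplitTorusCubicVanishing →
      (DeligneSerre1974.thm61_exists_adicGaloisRep ∧ Literature.NumberTheory.Automorphic.jacquetLanglands_cartanCover_newform) →
      Summit.BirchSwinnertonDyer.BirchSwinnertonDyer.Theses.ClassRecordThree.CartanOnePlaceDegreeLawAtThree :=
  fun hHF hMO hBCV hVAN hGT ↦ CartanOnePlaceDegreeLawAtThree_of₄ (splitFixedRankOne_of_heckeFamily hHF hMO) hBCV hVAN hGT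

/-- **THE CRUX DECL BY NAME on `KolyvaginRoadThree`** (twin) from the same five statements. -/
theorem CartanOnePlaceDegreeLawAtThree_of_heckecut' :
    CoverHeckeFamily → SplitLevelMultiplicityOne → BorelCubicEigenDocking → NonsplitTorusCubicVanishing →
      (DeligneSerre1974.thm61_exists_adicGaloisRep ∧ Literature.NumberTheory.Automorphic.jacquetLanglands_cartanCover_newform) →
      Summit.BirchSwinnertonDyer.BirchSwinnertonDyer.Theses.KolyvaginRoadThree.CartanOnePlaceDegreeLawAtThree :=
  fun hHF hMO hBCV hVAN hGT ↦ CartanOnePlaceDegreeLawAtThree_of₄' (splitFixedRankOne_of_heckeFamily hHF hMO) hBCV hVAN hGT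

/-- **The NUM♮ ITEM decl (32276) on `ClassRecordThree`** from the five statements. -/
theorem CartanOnePlaceDegreeLawAtThreeNatural_of_heckecut :
    CoverHeckeFamily → SplitLevelMultiplicityOne → BorelCubicEigenDocking → NonsplitTorusCubicVanishing →
      (DeligneSerre1974.thm61_exists_adicGaloisRep ∧ Literature.NumberTheory.Automorphic.jacquetLanglands_cartanCover_newform) →
      Summit.BirchSwinnertonDyer.BirchSwinnertonDyer.Theses.ClassRecordThree.CartanOnePlaceDegreeLawAtThreeNatural :=
  fun hHF hMO hBCV hVAN hGT ↦ CartanOnePlaceDegreeLawAtThreeNatural_of₄ (splitFixedRankOne_of_heckeFamily hHF hMO) hBCV hVAN hGT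

/-- **THIS NODE'S COMPOSITION — THE CRUX DECL BY NAME on `ClassRecordThree` from FOUR statements**: (MO1), (BCV), (VAN), ((DS) ∧ (JLᶜ)); (L1S) is the THEOREM
`splitFixedRankOne_of_multiplicityOne` ((HF♭) PROVED in §I), the character tables the THEOREM `cubicCharacterTables`, (SPH) the THEOREM `sphericalTransfer`. -/
theorem CartanOnePlaceDegreeLawAtThree_of_doublecoset :
    SplitLevelMultiplicityOne → BorelCubicEigenDocking → NonsplitTorusCubicVanishing →
      (DeligneSerre1974.thm61_exists_adicGaloisRep ∧ Literature.NumberTheory.Automorphic.jacquetLanglands_cartanCover_newform) →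
      Summit.BirchSwinnertonDyer.BirchSwinnertonDyer.Theses.ClassRecordThree.CartanOnePlaceDegreeLawAtThree :=
  fun hMO hBCV hVAN hGT ↦ CartanOnePlaceDegreeLawAtThree_of₄ (splitFixedRankOne_of_multiplicityOne hMO) hBCV hVAN hGT

/-- **THE CRUX DECL BY NAME on `KolyvaginRoadThree`** (twin) from the same four statements. -/
theorem CartanOnePlaceDegreeLawAtThree_of_doublecoset' :
    SplitLevelMultiplicityOne → BorelCubicEigenDocking → NonsplitTorusCubicVanishing →
      (DeligneSerre1974.thm61_exists_adicGaloisRep ∧ Literature.NumberTheory.Automorphic.jacquetLanglands_cartanCover_newform) →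
      Summit.BirchSwinnertonDyer.BirchSwinnertonDyer.Theses.KolyvaginRoadThree.CartanOnePlaceDegreeLawAtThree :=
  fun hMO hBCV hVAN hGT ↦ CartanOnePlaceDegreeLawAtThree_of₄' (splitFixedRankOne_of_multiplicityOne hMO) hBCV hVAN hGT

/-- **The NUM♮ ITEM decl (32276) on `ClassRecordThree`** from the four statements. -/
theorem CartanOnePlaceDegreeLawAtThreeNatural_of_doublecoset :
    SplitLevelMultiplicityOne → BorelCubicEigenDocking → NonsplitTorusCubicVanishing →
      (DeligneSerre1974.thm61_exists_adicGaloisRep ∧ Literature.NumberTheory.Automorphic.jacquetLanglands_cartanCover_newform) →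
      Summit.BirchSwinnertonDyer.BirchSwinnertonDyer.Theses.ClassRecordThree.CartanOnePlaceDegreeLawAtThreeNatural :=
  fun hMO hBCV hVAN hGT ↦ CartanOnePlaceDegreeLawAtThreeNatural_of₄ (splitFixedRankOne_of_multiplicityOne hMO) hBCV hVAN hGT

/-- **Generation 18's six-hypothesis composition is recovered** (verbatim generation 20). -/
theorem CartanOnePlaceDegreeLawAtThree_of₆ :
    SplitFixedRankOne → SphericalTransfer → BorelCubicEigenDocking → NonsplitTorusCubicVanishing →
      (CubicPrincipalSeriesCharacter ∧ CubicCuspidalCharacter) →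
      (DeligneSerre1974.thm61_exists_adicGaloisRep ∧ Literature.NumberTheory.Automorphic.jacquetLanglands_cartanCover_newform) →
      Summit.BirchSwinnertonDyer.BirchSwinnertonDyer.Theses.ClassRecordThree.CartanOnePlaceDegreeLawAtThree :=
  fun hL1S _ hBCV hVAN _ hGT ↦ CartanOnePlaceDegreeLawAtThree_of₄ hL1S hBCV hVAN hGT


end Summit.BirchSwinnertonDyer.BirchSwinnertonDyer.Theorems.CartanDoubleCoset

end
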